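import Summits.CriticalPhenomena.PercolationContinuityZ3.Theses.PercNearOneGluing
import Summits.CriticalPhenomena.PercolationContinuityZ3.Theorems.PercNearOneGluingAdditiveGluingOffClusterAssociation
import Literature.Probability.Percolation.TwoClusterConditionalAssociationProofs
import Literature.Probability.Percolation.ConditionalPositiveAssociationProofs
import HarnessLib

/-!
# Crux `PercNearOneGluing.AdditiveGluing` (stmt-CriticalPhenomena-4576), line `tieline`: the A-step
# (attachment off the relay cluster) — stub `stub_offClusterAttach_c13`

Support file (`--supports stmt-CriticalPhenomena-4576`, registered stub of line `tieline`, lead c13).  No definitions,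
no named facts, no sorries.

Weighted graph on `Fin n` (`μ = prodBernoulli w`, arbitrary edge weights), relays `u, v`, observer `o`, spectator `c`;
`D = {u ↮ v}`, `C_u = openEdgeCluster ω u`, `W̄ = {e | ∃ x ∈ e, x = u ∨ ∃ e' ∈ W, x ∈ e'}` (the pairs meeting
`{u} ∪ V(W)`), and the configuration off the relay cluster `ω ∖ C̄_u = ω \ W̄` at `W = C_u ω`.

**A-step.**  For an event `A` increasing in the open edge cluster `C_v` and
`M′ = {o ↔ v} ∪ ({o ↔ c} ∩ {c ↮ u})` ("`o` is joined to `v`, or to `c` by a path off the cluster of `u`"),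
`A` and `M′` are positively correlated given `D`:

  `μ(D ∩ A) · μ(D ∩ M′) ≤ μ(D) · μ(D ∩ A ∩ M′)`.

Proof (van den Berg–Häggström–Kahn, proof of Thm. 1.5 with Thm. 1.3, `s = u`, `X = {v}`).  On `D`, both events are
read off the pair `(C_u, ω ∖ C̄_u)`: `C_v(ω) = C_v(ω ∖ C̄_u)` (`BHK2006.openEdgeCluster_eq_sdiff_bar`), so
`ω ∈ A ↔ ω ∖ C̄_u ∈ A`; and `o ↔ v`, resp. `o ↔ c` with `c ↮ u`, are connections in the open graph of `ω ∖ C̄_u`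
(`OffCluster.reachable_off_iff`, `OffCluster.openConn_inter_compl_eq`), the side condition `c ↮ u` being
`c ∉ {u} ∪ V(C_u)`.  Both predicates are increasing in the off-cluster configuration and decreasing in `C_u`, hence
positively correlated given `{u ↮ v}` by the off-cluster association engine `OffCluster.offCluster_event_posAssoc`
(= condition on `C_u = W`, Harris in the fresh variables off `W̄`, antitonicity in `W` of both conditional averages,
Thm. 1.3).  The degenerate case `u = v` reads `0 ≤ 0`.
[cite: VandenbergHaggstromKahn2005, Thm. 1.3 (p. 6), Thm. 1.5 (pp. 7–8)]
-/

namespace Summit.CriticalPhenomena.PercolationContinuityZ3.Cruxes.AdditiveGluing.TieLine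

open MeasureTheory Set Literature.Probability.LatticeModels Literature.Probability.Percolation
open Literature.Probability.Percolation.BHK2006 (openGraph_le openEdgeCluster_mono openEdgeCluster_eq_sdiff_bar)

noncomputable section

namespace OffClusterAttach

variable {n : ℕ}

/-! ### The engine instance (`s = u`, `X = {v}`, predicates `1_A(ω ∖ C̄_u)` and `M′` off `C̄_u`) -/

/-- Off-cluster association, event form, for `{C_u ∩ {v} = ∅} = {u ↮ v}` and the two predicates of `(C_u, ω ∖ C̄_u)`
`P(C, E) = (E ∈ A)` and `Q(C, E) = (v ↔ o in E) ∨ ((c ↔ o in E) ∧ c ∉ {u} ∪ V(C))` (both decreasing in `C`,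
increasing in `E`):  `μ(D ∩ {P}) · μ(D ∩ {Q}) ≤ μ(D) · μ(D ∩ ({P} ∩ {Q}))`.
[cite: VandenbergHaggstromKahn2005, Thm. 1.3 (p. 6), Thm. 1.5 (pp. 7–8) — corollary] -/
theorem assoc (w : Sym2 (Fin n) → unitInterval) {u v : Fin n} (hu : u ∉ ({v} : Set (Fin n))) (o c : Fin n)
    {A : Set (BondConfig (Fin n))}
    (hA : ∀ ⦃ω ω' : BondConfig (Fin n)⦄, openEdgeCluster ω v ⊆ openEdgeCluster ω' v → ω ∈ A → ω' ∈ A) :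
    (prodBernoulli w).real ({ω : BondConfig (Fin n) | ∀ x ∈ ({v} : Set (Fin n)), ¬ (openGraph ω).Reachable u x} ∩
        {ω : BondConfig (Fin n) | ω \ {e | ∃ x ∈ e, x = u ∨ ∃ e' ∈ openEdgeCluster ω u, x ∈ e'} ∈ A}) *
      (prodBernoulli w).real ({ω : BondConfig (Fin n) | ∀ x ∈ ({v} : Set (Fin n)), ¬ (openGraph ω).Reachable u x} ∩
        {ω : BondConfig (Fin n) |
          (openGraph (ω \ {e | ∃ x ∈ e, x = u ∨ ∃ e' ∈ openEdgeCluster ω u, x ∈ e'})).Reachable v o ∨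
            ((openGraph (ω \ {e | ∃ x ∈ e, x = u ∨ ∃ e' ∈ openEdgeCluster ω u, x ∈ e'})).Reachable c o ∧
              ¬ (c = u ∨ ∃ e ∈ openEdgeCluster ω u, c ∈ e))}) ≤
    (prodBernoulli w).real {ω : BondConfig (Fin n) | ∀ x ∈ ({v} : Set (Fin n)), ¬ (openGraph ω).Reachable u x} *
      (prodBernoulli w).real ({ω : BondConfig (Fin n) | ∀ x ∈ ({v} : Set (Fin n)), ¬ (openGraph ω).Reachable u x} ∩
        ({ω : BondConfig (Fin n) | ω \ {e | ∃ x ∈ e, x = u ∨ ∃ e' ∈ openEdgeCluster ω u, x ∈ e'} ∈ A} ∩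
         {ω : BondConfig (Fin n) |
          (openGraph (ω \ {e | ∃ x ∈ e, x = u ∨ ∃ e' ∈ openEdgeCluster ω u, x ∈ e'})).Reachable v o ∨
            ((openGraph (ω \ {e | ∃ x ∈ e, x = u ∨ ∃ e' ∈ openEdgeCluster ω u, x ∈ e'})).Reachable c o ∧
              ¬ (c = u ∨ ∃ e ∈ openEdgeCluster ω u, c ∈ e))})) :=
  OffCluster.offCluster_event_posAssoc w u ({v} : Set (Fin n)) hu (fun _ E => E ∈ A)
    (fun C E => (openGraph E).Reachable v o ∨ ((openGraph E).Reachable c o ∧ ¬ (c = u ∨ ∃ e ∈ C, c ∈ e)))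
    (fun _ _ _ _ h => h) (fun _ _ _ hEE' h => hA (openEdgeCluster_mono hEE' v) h)
    (fun _ _ _ hCC' h => h.imp id fun h => ⟨h.1, fun h' => h.2 (h'.imp id fun ⟨e, he, hce⟩ => ⟨e, hCC' he, hce⟩)⟩)
    (fun _ _ _ hEE' h => h.imp (fun h => h.mono (openGraph_le hEE')) fun h => ⟨h.1.mono (openGraph_le hEE'), h.2⟩)

/-! ### Reading `A` and `M′` off `(C_u, ω ∖ C̄_u)` on `{u ↮ v}` -/

/-- On `{u ↮ v}`, `C_v(ω) = C_v(ω ∖ C̄_u)`, so an event determined by (and increasing in) `C_v` holds at `ω` iff it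
holds at the off-cluster configuration. [cite: VandenbergHaggstromKahn2005, §1 p. 8 (proof of Thm. 1.5)] -/
theorem mem_iff_off_mem {u v : Fin n} {A : Set (BondConfig (Fin n))}
    (hA : ∀ ⦃ω ω' : BondConfig (Fin n)⦄, openEdgeCluster ω v ⊆ openEdgeCluster ω' v → ω ∈ A → ω' ∈ A)
    {ω : BondConfig (Fin n)} (huv : ¬ (openGraph ω).Reachable u v) :
    ω ∈ A ↔ ω \ {e | ∃ x ∈ e, x = u ∨ ∃ e' ∈ openEdgeCluster ω u, x ∈ e'} ∈ A := by
  have hC : openEdgeCluster ω v =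
      openEdgeCluster (ω \ {e | ∃ x ∈ e, x = u ∨ ∃ e' ∈ openEdgeCluster ω u, x ∈ e'}) v :=
    openEdgeCluster_eq_sdiff_bar rfl fun h => huv ((reachable_iff_exists_mem_openEdgeCluster ω u v).2 h)
  exact ⟨fun h => hA hC.le h, fun h => hA hC.ge h⟩

/-- On `{u ↮ v}`, `M′ = {o ↔ v} ∪ ({o ↔ c} ∩ {c ↮ u})` reads `(v ↔ o in ω ∖ C̄_u) ∨ ((c ↔ o in ω ∖ C̄_u) ∧
c ∉ {u} ∪ V(C_u))` (paths from `v`, resp. from `c ↮ u`, never touch the cluster of `u`).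
[cite: VandenbergHaggstromKahn2005, §1 p. 8 (proof of Thm. 1.5)] -/
theorem mem_M_iff_off (o c : Fin n) {u v : Fin n} {ω : BondConfig (Fin n)} (huv : ¬ (openGraph ω).Reachable u v) :
    ((openGraph ω).Reachable o v ∨ ((openGraph ω).Reachable o c ∧ ¬ (openGraph ω).Reachable c u)) ↔
      (openGraph (ω \ {e | ∃ x ∈ e, x = u ∨ ∃ e' ∈ openEdgeCluster ω u, x ∈ e'})).Reachable v o ∨
        ((openGraph (ω \ {e | ∃ x ∈ e, x = u ∨ ∃ e' ∈ openEdgeCluster ω u, x ∈ e'})).Reachable c o ∧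
          ¬ (c = u ∨ ∃ e ∈ openEdgeCluster ω u, c ∈ e)) := by
  have hv := OffCluster.reachable_off_iff (ω := ω) (s := u) (x := v) (fun h => huv h.symm) o
  have hc := Set.ext_iff.1 (OffCluster.openConn_inter_compl_eq (V := Fin n) u c o) ω
  simp only [mem_inter_iff, mem_compl_iff, mem_setOf_eq, openConn] at hc
  constructor
  · rintro (hov | hoc)
    exacts [Or.inl (hv.1 hov.symm), Or.inr (hc.1 ⟨hoc.1.symm, hoc.2⟩)]
  · rintro (hvo | hco)
    exacts [Or.inl (hv.2 hvo).symm, Or.inr ⟨(hc.2 hco).1.symm, (hc.2 hco).2⟩]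

/-! ### Set identities -/

/-- `{C_u ∩ {v} = ∅} = {u ↮ v}`. [folklore] -/
theorem D_eq (u v : Fin n) :
    ({ω : BondConfig (Fin n) | ∀ x ∈ ({v} : Set (Fin n)), ¬ (openGraph ω).Reachable u x}) = (openConn u v)ᶜ := by
  ext ω
  simp only [mem_setOf_eq, mem_singleton_iff, forall_eq, mem_compl_iff, openConn]

/-- `{u ↮ v} ∩ {ω ∖ C̄_u ∈ A} = {u ↮ v} ∩ A` for `A` increasing in `C_v`. [cite: VandenbergHaggstromKahn2005, §1 p. 8] -/
theorem DA_eq (u v : Fin n) {A : Set (BondConfig (Fin n))}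
    (hA : ∀ ⦃ω ω' : BondConfig (Fin n)⦄, openEdgeCluster ω v ⊆ openEdgeCluster ω' v → ω ∈ A → ω' ∈ A) :
    ({ω : BondConfig (Fin n) | ∀ x ∈ ({v} : Set (Fin n)), ¬ (openGraph ω).Reachable u x} ∩
        {ω : BondConfig (Fin n) | ω \ {e | ∃ x ∈ e, x = u ∨ ∃ e' ∈ openEdgeCluster ω u, x ∈ e'} ∈ A} :
          Set (BondConfig (Fin n))) = (openConn u v)ᶜ ∩ A := by
  ext ω
  simp only [mem_inter_iff, mem_setOf_eq, mem_singleton_iff, forall_eq, mem_compl_iff, openConn]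
  exact and_congr_right fun huv => (mem_iff_off_mem hA huv).symm

/-- `{u ↮ v} ∩ {Q(C_u, ω ∖ C̄_u)} = {u ↮ v} ∩ M′`. [cite: VandenbergHaggstromKahn2005, §1 p. 8] -/
theorem DM_eq (o u v c : Fin n) :
    ({ω : BondConfig (Fin n) | ∀ x ∈ ({v} : Set (Fin n)), ¬ (openGraph ω).Reachable u x} ∩
        {ω : BondConfig (Fin n) |
          (openGraph (ω \ {e | ∃ x ∈ e, x = u ∨ ∃ e' ∈ openEdgeCluster ω u, x ∈ e'})).Reachable v o ∨
            ((openGraph (ω \ {e | ∃ x ∈ e, x = u ∨ ∃ e' ∈ openEdgeCluster ω u, x ∈ e'})).Reachable c o ∧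
              ¬ (c = u ∨ ∃ e ∈ openEdgeCluster ω u, c ∈ e))} : Set (BondConfig (Fin n))) =
      (openConn u v)ᶜ ∩ (openConn o v ∪ (openConn o c ∩ (openConn c u)ᶜ)) := by
  ext ω
  simp only [mem_inter_iff, mem_union, mem_compl_iff, mem_setOf_eq, mem_singleton_iff, forall_eq, openConn]
  exact and_congr_right fun huv => (mem_M_iff_off o c huv).symm

/-- `{u ↮ v} ∩ ({P} ∩ {Q}) = {u ↮ v} ∩ A ∩ M′`. [cite: VandenbergHaggstromKahn2005, §1 p. 8] -/
theorem DAM_eq (o u v c : Fin n) {A : Set (BondConfig (Fin n))}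
    (hA : ∀ ⦃ω ω' : BondConfig (Fin n)⦄, openEdgeCluster ω v ⊆ openEdgeCluster ω' v → ω ∈ A → ω' ∈ A) :
    ({ω : BondConfig (Fin n) | ∀ x ∈ ({v} : Set (Fin n)), ¬ (openGraph ω).Reachable u x} ∩
        ({ω : BondConfig (Fin n) | ω \ {e | ∃ x ∈ e, x = u ∨ ∃ e' ∈ openEdgeCluster ω u, x ∈ e'} ∈ A} ∩
         {ω : BondConfig (Fin n) |
          (openGraph (ω \ {e | ∃ x ∈ e, x = u ∨ ∃ e' ∈ openEdgeCluster ω u, x ∈ e'})).Reachable v o ∨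
            ((openGraph (ω \ {e | ∃ x ∈ e, x = u ∨ ∃ e' ∈ openEdgeCluster ω u, x ∈ e'})).Reachable c o ∧
              ¬ (c = u ∨ ∃ e ∈ openEdgeCluster ω u, c ∈ e))}) : Set (BondConfig (Fin n))) =
      (openConn u v)ᶜ ∩ A ∩ (openConn o v ∪ (openConn o c ∩ (openConn c u)ᶜ)) := by
  rw [Set.inter_inter_distrib_left, DA_eq u v hA, DM_eq o u v c, ← Set.inter_inter_distrib_left, Set.inter_assoc]

/-- Degenerate case `u = v`: `{u ↮ u} = ∅`. [folklore] -/
theorem notConn_self_eq_empty (u : Fin n) : ((openConn u u)ᶜ : Set (BondConfig (Fin n))) = ∅ :=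
  Set.eq_empty_of_forall_notMem fun _ hω => (Set.mem_compl_iff _ _).1 hω (SimpleGraph.Reachable.refl u)

end OffClusterAttach

open OffClusterAttach in
/-- **A-step (attachment off the relay cluster)** (line `tieline`, crux `AdditiveGluing`; lead c13, stub
`stub_offClusterAttach_c13`): for `A` increasing in `C_v`, `D = {u ↮ v}`, `M′ = {o ↔ v} ∪ ({o ↔ c} ∩ {c ↮ u})`:
`μ(D ∩ A) · μ(D ∩ M′) ≤ μ(D) · μ(D ∩ A ∩ M′)`.  It is the positive correlation, given `C_u ∩ {v} = ∅`, of the two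
predicates `ω ∖ C̄_u ∈ A` and "`o` joins `v` or `c ∉ {u} ∪ V(C_u)` in `ω ∖ C̄_u`" of `(C_u, ω ∖ C̄_u)` (decreasing in
`C_u`, increasing off `C̄_u`) — the event form `OffCluster.offCluster_event_posAssoc` of the off-cluster association
engine (van den Berg–Häggström–Kahn: condition on `C_u = W`, Harris off `W̄`, Thm. 1.3 for the antitone conditional
averages). [cite: VandenbergHaggstromKahn2005, Thm. 1.3 (p. 6), Thm. 1.5 proof (pp. 7–8)] -/
theorem stub_offClusterAttach_c13 : ∀ (n : ℕ) (w : Sym2 (Fin n) → unitInterval) (o u v c : Fin n)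
    (A : Set (Literature.Probability.Percolation.BondConfig (Fin n))),
    (∀ ⦃ω ω' : Literature.Probability.Percolation.BondConfig (Fin n)⦄,
      Literature.Probability.Percolation.openEdgeCluster ω v ⊆ Literature.Probability.Percolation.openEdgeCluster ω' v → ω ∈ A → ω' ∈ A) →
    (Literature.Probability.LatticeModels.prodBernoulli w).real
        ((Literature.Probability.Percolation.openConn u v)ᶜ ∩ A : Set (Literature.Probability.Percolation.BondConfig (Fin n))) *
      (Literature.Probability.LatticeModels.prodBernoulli w).real
        ((Literature.Probability.Percolation.openConn u v)ᶜ ∩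
          (Literature.Probability.Percolation.openConn o v ∪
            (Literature.Probability.Percolation.openConn o c ∩ (Literature.Probability.Percolation.openConn c u)ᶜ)) :
          Set (Literature.Probability.Percolation.BondConfig (Fin n))) ≤
    (Literature.Probability.LatticeModels.prodBernoulli w).real
        ((Literature.Probability.Percolation.openConn u v)ᶜ : Set (Literature.Probability.Percolation.BondConfig (Fin n))) *
      (Literature.Probability.LatticeModels.prodBernoulli w).real
        ((Literature.Probability.Percolation.openConn u v)ᶜ ∩ A ∩
          (Literature.Probability.Percolation.openConn o v ∪
            (Literature.Probability.Percolation.openConn o c ∩ (Literature.Probability.Percolation.openConn c u)ᶜ)) :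
          Set (Literature.Probability.Percolation.BondConfig (Fin n))) := by
  intro n w o u v c A hA
  by_cases hu : u ∈ ({v} : Set (Fin n))
  · -- degenerate `u = v`: `{u ↮ v} = ∅`, both sides vanish
    rw [Set.mem_singleton_iff] at hu
    subst hu
    simp only [notConn_self_eq_empty, Set.empty_inter, measureReal_empty, zero_mul, le_refl]
  · -- the engine instance, rewritten along the set identities
    have key := assoc w hu o c hA
    rw [DA_eq u v hA, DM_eq o u v c, DAM_eq o u v c hA, D_eq u v] at key
    exact key

end

end Summit.CriticalPhenomena.PercolationContinuityZ3.Cruxes.AdditiveGluing.TieLine
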